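import Literature.AlgebraicGeometry.Deformation.SmoothSchemeLiftObstructionFunctorial
import HarnessLib

/-!
# Functoriality of the obstruction derivation with THREE chart lifts; the defect of a pair of lifts is a derivation
# (Hartshorne, *Deformation Theory*, Remark 10.1.1 / proof of Thm. 10.2; Illusie's functoriality of the obstruction)

Layer `Literature/AlgebraicGeometry/Deformation`, namespace `Literature.AlgebraicGeometry.Deformation.SmoothAffineDeformation`
(THEOREMS only: no definition, no instance, no notation, no named fact).  Sequel of ★ `SmoothSchemeLiftObstructionFunctorial`
(`obstructionDerivation_functorial`: ONE chart lift `F` intertwining all three pairs of lifted transition automorphisms modulo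
`J`).  On a triple overlap `U_j ∩ U_l ∩ U_m` of a morphism of deformations `f₀ : Y₀ → X₀` over `A = A'/J` lifted CHARTWISE, the three
restricted lifts `F_j, F_l, F_m : A' ⊗_k Γ(X, U_jlm) → A' ⊗_k Γ(Y, U′_jlm)` lift three DIFFERENT reductions (`f₀♯` read in the `j`-,
`l`-, `m`-trivialisations, intertwined by the transition data: `G_l φ^X_{jl} = φ^Y_{jl} G_j`), so the hypotheses of the Čech
bookkeeping are `F_l ψ_{jl} ≡ φ_{jl} F_j`, `F_m ψ_{lm} ≡ φ_{lm} F_l`, `F_m ψ_{jm} ≡ φ_{jm} F_j (mod J)` with DEFECTS `ε_{jl}, ε_{lm}, ε_{jm}`.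
This file proves the corresponding identity of obstruction derivations (same chase as ★, one lift per chart):

  `(g ⊗ 1)(D b) = D₁(g b) + ε_{jl} b + ε_{lm} b − ε_{jm} b`          (`obstructionDerivation_functorial₃`),

and records that the DEFECT `ε` of a pair of lifts `(F, F')` of the same `g` modulo `𝔫'` is a `g`-DERIVATION
(`defect₂_mul`: `ε(bc) = g(b)·ε(c) + g(c)·ε(b)` in `B₁ ⊗_k J`) — the input that makes the defect cochain a section of
`𝓗om(Ω¹_X, f_*𝒪_Y) ⊗ J` on affine overlaps (Čech bookkeeping file `SmoothSchemeLiftObstructionFunctorialCech`).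

* §1 two-lift defects `x ↦ F'(ψ' x) − φ'(F x)`: `J`-valued (`defect₂_mem_smul_top`), kill `𝔫'(A' ⊗ B₀)` (`defect₂_eq_zero_of_mem_smul`),
  invariant under `≡ 1 (mod 𝔫')` perturbations of the argument (`defect₂_apply_of_sub_mem`);
* §2 **`obstructionDerivation_functorial₃`**;
* §3 **`defect₂_mul`** (Leibniz rule of the defect; `J² = 0`, `J𝔫' = 0`).

Cell `hodgecm-mathlib` (D-0151), F-11 sub-line `Cruxes/HDel/Lines/F11LiftWithLineBundle` G1 / J4-(iv) road (a′) brick (iv-1b) FILE A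
(F0P1b-plan (g0) (R34) → B-p08 (g16); census 2026-08-30T23:34Z FINDING 1–2).  HC_CM is proved only modulo the 7 printed citations until
rung 0 closes — nothing here bears on a summit statement.

## References
* [Hartshorne2010] R. Hartshorne, *Deformation Theory*, GTM 257, Springer (2010): Remark 10.1.1 (p. 80), Thm. 10.2 (a) and its proof
  (p. 81), Cor. 10.3 (p. 82), Lemma 4.5 (p. 28).
* (prose only) L. Illusie, in *FGA Explained*, AMS (2005), §8.5 (functoriality of the obstruction); F. Oort, *Finite group schemes, local
  moduli for abelian varieties, and lifting problems*, Compositio Math. 23 (1971), §2.2.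
-/

noncomputable section

open TensorProduct

namespace Literature.AlgebraicGeometry.Deformation.SmoothAffineDeformation

variable {k : Type*} [CommRing k]
variable {A' : Type*} [CommRing A'] [Algebra k A']
variable {B₀ : Type*} [CommRing B₀] [Algebra k B₀]
variable {B₁ : Type*} [CommRing B₁] [Algebra k B₁]
variable (J : Ideal A')

/-! ## §1 The defect of TWO lifts intertwining a pair of automorphisms modulo `J` -/

section Defect₂

variable {𝔫' : Ideal A'} (F F' : A' ⊗[k] B₀ →ₐ[A'] A' ⊗[k] B₁)
  (ψ' : A' ⊗[k] B₀ ≃ₐ[A'] A' ⊗[k] B₀) (φ' : A' ⊗[k] B₁ ≃ₐ[A'] A' ⊗[k] B₁)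

/-- **The two-lift defect `x ↦ F'(ψ' x) − φ'(F x)` is `J`-valued everywhere** if it is on the pure tensors `1 ⊗ b`
(`A'`-linearity: `a ⊗ b = a · (1 ⊗ b)`). [cite: Hartshorne2010, Thm. 10.2 (proof), p. 81] -/
theorem defect₂_mem_smul_top
    (hc : ∀ b : B₀, F' (ψ' ((1 : A') ⊗ₜ b)) - φ' (F ((1 : A') ⊗ₜ b)) ∈ J • (⊤ : Submodule A' (A' ⊗[k] B₁)))
    (x : A' ⊗[k] B₀) : F' (ψ' x) - φ' (F x) ∈ J • (⊤ : Submodule A' (A' ⊗[k] B₁)) := by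
  induction x using TensorProduct.induction_on with
  | zero => simp
  | tmul a b =>
    have h : (a ⊗ₜ[k] b : A' ⊗[k] B₀) = a • ((1 : A') ⊗ₜ[k] b) := by
      rw [TensorProduct.smul_tmul', smul_eq_mul, mul_one]
    rw [h, map_smul, map_smul, map_smul, map_smul, ← smul_sub]
    exact Submodule.smul_mem _ a (hc b)
  | add x y hx hy =>
    have h : F' (ψ' (x + y)) - φ' (F (x + y)) = (F' (ψ' x) - φ' (F x)) + (F' (ψ' y) - φ' (F y)) := by
      simp only [map_add]; abel
    rw [h]
    exact Submodule.add_mem _ hx hy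

/-- **The two-lift defect kills `𝔫'(A' ⊗_k B₀)`** (`J𝔫' = 0`). [cite: Hartshorne2010, Thm. 10.2 (proof), p. 81] -/
theorem defect₂_eq_zero_of_mem_smul (hJ𝔫 : J * 𝔫' = ⊥)
    (hc : ∀ b : B₀, F' (ψ' ((1 : A') ⊗ₜ b)) - φ' (F ((1 : A') ⊗ₜ b)) ∈ J • (⊤ : Submodule A' (A' ⊗[k] B₁)))
    {n : A' ⊗[k] B₀} (hn : n ∈ 𝔫' • (⊤ : Submodule A' (A' ⊗[k] B₀))) : F' (ψ' n) - φ' (F n) = 0 := by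
  refine Submodule.smul_induction_on hn (fun a ha y _ => ?_) (fun x y hx hy => ?_)
  · rw [map_smul, map_smul, map_smul, map_smul, ← smul_sub]
    exact smul_eq_zero_of_mem_of_mem_smul_top (by rwa [mul_comm] at hJ𝔫) ha (defect₂_mem_smul_top J F F' ψ' φ' hc y)
  · have h : F' (ψ' (x + y)) - φ' (F (x + y)) = (F' (ψ' x) - φ' (F x)) + (F' (ψ' y) - φ' (F y)) := by
      simp only [map_add]; abel
    rw [h, hx, hy, add_zero]

/-- **The two-lift defect takes the same value at `y` and `x` when `y − x ∈ 𝔫'(A' ⊗_k B₀)`.**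
[cite: Hartshorne2010, Thm. 10.2 (proof), p. 81] -/
theorem defect₂_apply_of_sub_mem (hJ𝔫 : J * 𝔫' = ⊥)
    (hc : ∀ b : B₀, F' (ψ' ((1 : A') ⊗ₜ b)) - φ' (F ((1 : A') ⊗ₜ b)) ∈ J • (⊤ : Submodule A' (A' ⊗[k] B₁)))
    {x y : A' ⊗[k] B₀} (hxy : y - x ∈ 𝔫' • (⊤ : Submodule A' (A' ⊗[k] B₀))) :
    F' (ψ' y) - φ' (F y) = F' (ψ' x) - φ' (F x) := by
  have h := defect₂_eq_zero_of_mem_smul J F F' ψ' φ' hJ𝔫 hc hxy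
  have e : F' (ψ' y) - φ' (F y) = (F' (ψ' x) - φ' (F x)) + (F' (ψ' (y - x)) - φ' (F (y - x))) := by
    simp only [map_sub]; abel
  rw [e, h, add_zero]

end Defect₂

/-! ## §2 Functoriality of the obstruction derivation, three chart lifts -/

/-- **FUNCTORIALITY OF THE OBSTRUCTION DERIVATION with one chart lift per chart** (Illusie: «the obstruction is functorial»;
the form the Čech bookkeeping consumes).  `F₁, F₂, F₃ : A' ⊗_k B₀ → A' ⊗_k B₁` are `A'`-algebra maps (the three chart lifts
restricted to a triple overlap), `F₃` reducing to `1 ⊗ g` modulo `𝔫'` (only the last lift's reduction is used); `ψ'ᵢⱼ` (on `B₀`)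
and `φ'ᵢⱼ` (on `B₁`) are lifted transition
automorphisms inducing the identity modulo `𝔫'`, intertwined MODULO `J` by the PAIR of lifts of their two charts, with defects
`εᵢⱼ`:  `F₂(ψ'₁₂(1 ⊗ b)) = φ'₁₂(F₁(1 ⊗ b)) + ι(ε₁₂ b)`, `F₃(ψ'₂₃(1 ⊗ b)) = φ'₂₃(F₂(1 ⊗ b)) + ι(ε₂₃ b)`,
`F₃(ψ'₁₃(1 ⊗ b)) = φ'₁₃(F₁(1 ⊗ b)) + ι(ε₁₃ b)`.  Then the obstruction derivations `θ_D = ψ'₂₃ψ'₁₂ψ'₁₃⁻¹`, `θ_{D₁} = φ'₂₃φ'₁₂φ'₁₃⁻¹`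
satisfy **`(g ⊗ 1)(D b) = D₁(g b) + ε₁₂ b + ε₂₃ b − ε₁₃ b`** (`B₁` flat over `k`).  With `F₁ = F₂ = F₃`: ★ `obstructionDerivation_functorial`.
[cite: Hartshorne2010, Thm. 10.2 (proof), p. 81] [cite: Hartshorne2010, Remark 10.1.1, p. 80] [cite: Hartshorne2010, Cor. 10.3, p. 82] -/
theorem obstructionDerivation_functorial₃ [Module.Flat k B₁] (hJ : J * J = ⊥) {𝔫' : Ideal A'} (hJ𝔫 : J * 𝔫' = ⊥)
    (F₁ F₂ F₃ : A' ⊗[k] B₀ →ₐ[A'] A' ⊗[k] B₁) (g : B₀ →ₐ[k] B₁)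
    (hF₃ : ∀ b : B₀, F₃ ((1 : A') ⊗ₜ b) - (1 : A') ⊗ₜ g b ∈ 𝔫' • (⊤ : Submodule A' (A' ⊗[k] B₁)))
    {ψ'₁₂ ψ'₂₃ ψ'₁₃ : A' ⊗[k] B₀ ≃ₐ[A'] A' ⊗[k] B₀} {φ'₁₂ φ'₂₃ φ'₁₃ : A' ⊗[k] B₁ ≃ₐ[A'] A' ⊗[k] B₁}
    (hψ₁₂ : ∀ x, ψ'₁₂ x - x ∈ 𝔫' • (⊤ : Submodule A' (A' ⊗[k] B₀)))
    (hψ₁₃ : ∀ x, ψ'₁₃ x - x ∈ 𝔫' • (⊤ : Submodule A' (A' ⊗[k] B₀)))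
    (hφ₁₂ : ∀ x, φ'₁₂ x - x ∈ 𝔫' • (⊤ : Submodule A' (A' ⊗[k] B₁)))
    (hφ₂₃ : ∀ x, φ'₂₃ x - x ∈ 𝔫' • (⊤ : Submodule A' (A' ⊗[k] B₁)))
    (hφ₁₃ : ∀ x, φ'₁₃ x - x ∈ 𝔫' • (⊤ : Submodule A' (A' ⊗[k] B₁)))
    (ε₁₂ ε₂₃ ε₁₃ : B₀ →ₗ[k] B₁ ⊗[k] ↥(J.restrictScalars k))
    (hc₁₂ : ∀ b : B₀, F₂ (ψ'₁₂ ((1 : A') ⊗ₜ b)) = φ'₁₂ (F₁ ((1 : A') ⊗ₜ b)) + idealTensorIncl J (ε₁₂ b))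
    (hc₂₃ : ∀ b : B₀, F₃ (ψ'₂₃ ((1 : A') ⊗ₜ b)) = φ'₂₃ (F₂ ((1 : A') ⊗ₜ b)) + idealTensorIncl J (ε₂₃ b))
    (hc₁₃ : ∀ b : B₀, F₃ (ψ'₁₃ ((1 : A') ⊗ₜ b)) = φ'₁₃ (F₁ ((1 : A') ⊗ₜ b)) + idealTensorIncl J (ε₁₃ b))
    {D : Derivation k B₀ (B₀ ⊗[k] ↥(J.restrictScalars k))} {D₁ : Derivation k B₁ (B₁ ⊗[k] ↥(J.restrictScalars k))}
    (hD : infinitesimalAut J hJ D = ψ'₂₃ * ψ'₁₂ * ψ'₁₃⁻¹) (hD₁ : infinitesimalAut J hJ D₁ = φ'₂₃ * φ'₁₂ * φ'₁₃⁻¹)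
    (b : B₀) :
    g.toLinearMap.rTensor _ (D b) = D₁ (g b) + ε₁₂ b + ε₂₃ b - ε₁₃ b := by
  -- the defects are `J`-valued on pure tensors
  have hJmem : ∀ (ε : B₀ →ₗ[k] B₁ ⊗[k] ↥(J.restrictScalars k)) (b : B₀),
      idealTensorIncl J (ε b) ∈ J • (⊤ : Submodule A' (A' ⊗[k] B₁)) := fun ε b => idealTensorIncl_mem J (ε b)
  have hc₁₂' : ∀ b : B₀, F₂ (ψ'₁₂ ((1 : A') ⊗ₜ b)) - φ'₁₂ (F₁ ((1 : A') ⊗ₜ b)) ∈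
      J • (⊤ : Submodule A' (A' ⊗[k] B₁)) := fun b => by rw [hc₁₂, add_sub_cancel_left]; exact hJmem ε₁₂ b
  have hc₂₃' : ∀ b : B₀, F₃ (ψ'₂₃ ((1 : A') ⊗ₜ b)) - φ'₂₃ (F₂ ((1 : A') ⊗ₜ b)) ∈
      J • (⊤ : Submodule A' (A' ⊗[k] B₁)) := fun b => by rw [hc₂₃, add_sub_cancel_left]; exact hJmem ε₂₃ b
  have hc₁₃' : ∀ b : B₀, F₃ (ψ'₁₃ ((1 : A') ⊗ₜ b)) - φ'₁₃ (F₁ ((1 : A') ⊗ₜ b)) ∈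
      J • (⊤ : Submodule A' (A' ⊗[k] B₁)) := fun b => by rw [hc₁₃, add_sub_cancel_left]; exact hJmem ε₁₃ b
  set x : A' ⊗[k] B₀ := (1 : A') ⊗ₜ b with hx
  -- `y₃ := ψ'₁₃⁻¹ x`, `y₂ := ψ'₁₂ y₃`; both `≡ x (mod 𝔫')`
  have hy₃ : ψ'₁₃⁻¹ x - x ∈ 𝔫' • (⊤ : Submodule A' (A' ⊗[k] B₀)) := inv_apply_sub_mem ψ'₁₃ hψ₁₃ x
  have hy₂ : ψ'₁₂ (ψ'₁₃⁻¹ x) - x ∈ 𝔫' • (⊤ : Submodule A' (A' ⊗[k] B₀)) := by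
    have e : ψ'₁₂ (ψ'₁₃⁻¹ x) - x = (ψ'₁₂ (ψ'₁₃⁻¹ x) - ψ'₁₃⁻¹ x) + (ψ'₁₃⁻¹ x - x) := by abel
    rw [e]; exact Submodule.add_mem _ (hψ₁₂ _) hy₃
  -- step 3 (pair `13`, lifts `F₁ → F₃`): `F₁ y₃ = φ'₁₃⁻¹ (F₃ x) - ι(ε₁₃ b)`
  have h13 : F₃ (ψ'₁₃ (ψ'₁₃⁻¹ x)) - φ'₁₃ (F₁ (ψ'₁₃⁻¹ x)) = idealTensorIncl J (ε₁₃ b) := by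
    rw [defect₂_apply_of_sub_mem J F₁ F₃ ψ'₁₃ φ'₁₃ hJ𝔫 hc₁₃' hy₃, hx, hc₁₃, add_sub_cancel_left]
  rw [← AlgEquiv.mul_apply, mul_inv_cancel, AlgEquiv.one_apply] at h13
  have hFy₃ : F₁ (ψ'₁₃⁻¹ x) = φ'₁₃⁻¹ (F₃ x) - idealTensorIncl J (ε₁₃ b) := by
    have e1 : φ'₁₃ (F₁ (ψ'₁₃⁻¹ x)) = F₃ x - idealTensorIncl J (ε₁₃ b) := by rw [← h13]; abel
    have e2 : F₁ (ψ'₁₃⁻¹ x) = φ'₁₃⁻¹ (F₃ x - idealTensorIncl J (ε₁₃ b)) := by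
      rw [show (φ'₁₃⁻¹ : A' ⊗[k] B₁ ≃ₐ[A'] A' ⊗[k] B₁) = φ'₁₃.symm from AlgEquiv.aut_inv φ'₁₃,
        AlgEquiv.eq_symm_apply]
      exact e1
    rw [e2, map_sub, apply_eq_self_of_mem_smul J hJ𝔫 φ'₁₃⁻¹ (inv_apply_sub_mem φ'₁₃ hφ₁₃) (hJmem ε₁₃ b)]
  -- step 2 (pair `12`, lifts `F₁ → F₂`): `F₂ y₂ = φ'₁₂ (F₁ y₃) + ι(ε₁₂ b)`
  have hFy₂ : F₂ (ψ'₁₂ (ψ'₁₃⁻¹ x)) = φ'₁₂ (F₁ (ψ'₁₃⁻¹ x)) + idealTensorIncl J (ε₁₂ b) := by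
    have h := defect₂_apply_of_sub_mem J F₁ F₂ ψ'₁₂ φ'₁₂ hJ𝔫 hc₁₂' hy₃
    rw [hx, hc₁₂, add_sub_cancel_left, ← hx] at h
    rw [← h]; abel
  -- step 1 (pair `23`, lifts `F₂ → F₃`): `F₃ (ψ'₂₃ y₂) = φ'₂₃ (F₂ y₂) + ι(ε₂₃ b)`
  have hFy₁ : F₃ (ψ'₂₃ (ψ'₁₂ (ψ'₁₃⁻¹ x))) = φ'₂₃ (F₂ (ψ'₁₂ (ψ'₁₃⁻¹ x))) + idealTensorIncl J (ε₂₃ b) := by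
    have h := defect₂_apply_of_sub_mem J F₂ F₃ ψ'₂₃ φ'₂₃ hJ𝔫 hc₂₃' hy₂
    rw [hx, hc₂₃, add_sub_cancel_left, ← hx] at h
    rw [← h]; abel
  -- assemble `F₃ (θ_D x) = θ_{D₁} (F₃ x) + ι(ε₁₂ b + ε₂₃ b - ε₁₃ b)`
  have hθ : F₃ (infinitesimalAut J hJ D x) =
      infinitesimalAut J hJ D₁ (F₃ x) + idealTensorIncl J (ε₁₂ b + ε₂₃ b - ε₁₃ b) := by
    rw [hD, hD₁, AlgEquiv.mul_apply, AlgEquiv.mul_apply, AlgEquiv.mul_apply, AlgEquiv.mul_apply, hFy₁, hFy₂, hFy₃,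
      map_sub, map_add, map_sub,
      apply_eq_self_of_mem_smul J hJ𝔫 φ'₁₂ hφ₁₂ (hJmem ε₁₃ b),
      apply_eq_self_of_mem_smul J hJ𝔫 φ'₂₃ hφ₂₃ (hJmem ε₁₃ b),
      apply_eq_self_of_mem_smul J hJ𝔫 φ'₂₃ hφ₂₃ (hJmem ε₁₂ b), map_sub, map_add]
    abel
  -- read both sides on `x = 1 ⊗ b`
  have hL : F₃ (infinitesimalAut J hJ D x) = F₃ x + idealTensorIncl J (g.toLinearMap.rTensor _ (D b)) := by
    rw [hx, infinitesimalAut_one_tmul, map_add, algHom_idealTensorIncl J hJ𝔫 F₃ g hF₃]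
  have hR : infinitesimalAut J hJ D₁ (F₃ x) = F₃ x + idealTensorIncl J (D₁ (g b)) := by
    have e : F₃ x = (1 : A') ⊗ₜ g b + (F₃ x - (1 : A') ⊗ₜ g b) := by abel
    rw [infinitesimalAut_apply, add_right_inj, e, map_add, derivationExtension_tmul, one_smul,
      derivationExtension_apply_eq_zero_of_mem_smul J hJ𝔫 D₁ (hF₃ b), add_zero]
  rw [hL, hR, add_assoc, add_right_inj, ← map_add] at hθ
  have := idealTensorIncl_injective (A' := A') J hθ
  rw [this]
  abel

/-! ## §3 The defect of a pair of lifts is a `g`-derivation -/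

/-- **LEIBNIZ RULE OF THE DEFECT.**  Let `F, F' : A' ⊗_k B₀ → A' ⊗_k B₁` both reduce to `1 ⊗ g` modulo `𝔫'`, and let `ψ'`
(`≡ 1 (mod 𝔫')`) and `φ'` (`≡ 1 (mod 𝔫')`) be intertwined by the pair modulo `J` with defect `ε`: `F'(ψ'(1 ⊗ b)) = φ'(F(1 ⊗ b)) + ι(ε b)`.
Then `ε(bc) = g(b) · ε(c) + g(c) · ε(b)` in the `B₁`-module `B₁ ⊗_k J` (`J² = 0` kills `ι(ε b) ι(ε c)`; `J𝔫' = 0` lets the factors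
`φ'(F(1 ⊗ b)) ≡ 1 ⊗ g b (mod 𝔫')` act on `ι(ε c)` through `g b`): the defect is a `g`-DERIVATION `B₀ → B₁ ⊗_k J`, hence a section of
`𝓗om(Ω¹, f_*𝒪) ⊗ J` on an affine chart. [cite: Hartshorne2010, Remark 10.1.1, p. 80] [cite: Hartshorne2010, Lemma 4.5, p. 28] -/
theorem defect₂_mul [Module.Flat k B₁] (hJ : J * J = ⊥) {𝔫' : Ideal A'} (hJ𝔫 : J * 𝔫' = ⊥)
    (F F' : A' ⊗[k] B₀ →ₐ[A'] A' ⊗[k] B₁) (g : B₀ →ₐ[k] B₁)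
    (hF : ∀ b : B₀, F ((1 : A') ⊗ₜ b) - (1 : A') ⊗ₜ g b ∈ 𝔫' • (⊤ : Submodule A' (A' ⊗[k] B₁)))
    (ψ' : A' ⊗[k] B₀ ≃ₐ[A'] A' ⊗[k] B₀) (φ' : A' ⊗[k] B₁ ≃ₐ[A'] A' ⊗[k] B₁)
    (hφ : ∀ x, φ' x - x ∈ 𝔫' • (⊤ : Submodule A' (A' ⊗[k] B₁)))
    (ε : B₀ →ₗ[k] B₁ ⊗[k] ↥(J.restrictScalars k))
    (hc : ∀ b : B₀, F' (ψ' ((1 : A') ⊗ₜ b)) = φ' (F ((1 : A') ⊗ₜ b)) + idealTensorIncl J (ε b))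
    (b c : B₀) :
    ε (b * c) = g b • ε c + g c • ε b := by
  apply idealTensorIncl_injective (A' := A') J
  have hJmem : ∀ b : B₀, idealTensorIncl J (ε b) ∈ J • (⊤ : Submodule A' (A' ⊗[k] B₁)) :=
    fun b => idealTensorIncl_mem J (ε b)
  -- `φ'(F(1 ⊗ b)) = 1 ⊗ g b + n_b` with `n_b ∈ 𝔫'(A' ⊗ B₁)`
  have hn : ∀ b : B₀, φ' (F ((1 : A') ⊗ₜ b)) - (1 : A') ⊗ₜ g b ∈ 𝔫' • (⊤ : Submodule A' (A' ⊗[k] B₁)) := fun b => by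
    have e : φ' (F ((1 : A') ⊗ₜ b)) - (1 : A') ⊗ₜ g b =
        (φ' (F ((1 : A') ⊗ₜ b)) - F ((1 : A') ⊗ₜ b)) + (F ((1 : A') ⊗ₜ b) - (1 : A') ⊗ₜ g b) := by abel
    rw [e]
    exact Submodule.add_mem _ (hφ _) (hF b)
  -- a `J`-element times an `𝔫'`-element vanishes (`J𝔫' = 0`)
  have hJn : ∀ {x y : A' ⊗[k] B₁}, x ∈ J • (⊤ : Submodule A' (A' ⊗[k] B₁)) →
      y ∈ 𝔫' • (⊤ : Submodule A' (A' ⊗[k] B₁)) → y * x = 0 := by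
    intro x y hx hy
    refine Submodule.smul_induction_on hy (fun n hn' z _ => ?_) (fun y₁ y₂ h₁ h₂ => by rw [add_mul, h₁, h₂, add_zero])
    rw [smul_mul_assoc]
    refine smul_eq_zero_of_mem_of_mem_smul_top (by rwa [mul_comm] at hJ𝔫) hn' ?_
    refine Submodule.smul_induction_on hx (fun j hj w _ => ?_) (fun x₁ x₂ h₁ h₂ => by rw [mul_add]; exact Submodule.add_mem _ h₁ h₂)
    rw [mul_smul_comm]
    exact Submodule.smul_mem_smul hj Submodule.mem_top
  -- expand `F'ψ'(1 ⊗ bc)` and `φ'F(1 ⊗ bc)` multiplicatively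
  have e0 : ((1 : A') ⊗ₜ[k] (b * c) : A' ⊗[k] B₀) = (1 ⊗ₜ b) * (1 ⊗ₜ c) := by simp
  have h := hc (b * c)
  rw [e0, map_mul, map_mul, map_mul, map_mul, hc b, hc c] at h
  -- `h : (φF b + ιε b)(φF c + ιε c) = φF b · φF c + ι(ε(bc))`
  have hcross : idealTensorIncl (A' := A') J (ε b) * idealTensorIncl J (ε c) = 0 :=
    mul_eq_zero_of_mem_of_mem hJ (hJmem b) (hJmem c)
  have hb : φ' (F ((1 : A') ⊗ₜ b)) * idealTensorIncl (A' := A') J (ε c) = (1 ⊗ₜ g b) * idealTensorIncl J (ε c) := by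
    have e : φ' (F ((1 : A') ⊗ₜ b)) = (1 : A') ⊗ₜ g b + (φ' (F ((1 : A') ⊗ₜ b)) - (1 : A') ⊗ₜ g b) := by abel
    rw [e, add_mul, hJn (hJmem c) (hn b), add_zero]
  have hc' : idealTensorIncl (A' := A') J (ε b) * φ' (F ((1 : A') ⊗ₜ c)) = (1 ⊗ₜ g c) * idealTensorIncl J (ε b) := by
    have e : φ' (F ((1 : A') ⊗ₜ c)) = (1 : A') ⊗ₜ g c + (φ' (F ((1 : A') ⊗ₜ c)) - (1 : A') ⊗ₜ g c) := by abel
    rw [e, mul_add, mul_comm (idealTensorIncl J (ε b)) (φ' (F (1 ⊗ₜ[k] c)) - 1 ⊗ₜ[k] g c), hJn (hJmem b) (hn c), add_zero,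
      mul_comm]
  have key : idealTensorIncl (A' := A') J (ε (b * c)) =
      (1 ⊗ₜ g b) * idealTensorIncl J (ε c) + (1 ⊗ₜ g c) * idealTensorIncl J (ε b) := by
    have e : idealTensorIncl (A' := A') J (ε (b * c)) =
        (φ' (F ((1 : A') ⊗ₜ b)) + idealTensorIncl J (ε b)) * (φ' (F ((1 : A') ⊗ₜ c)) + idealTensorIncl J (ε c)) -
          φ' (F ((1 : A') ⊗ₜ b)) * φ' (F ((1 : A') ⊗ₜ c)) := by rw [h]; abel
    rw [e, add_mul, mul_add, mul_add, hcross, hb, hc']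
    abel
  rw [key, map_add, idealTensorIncl_smul, idealTensorIncl_smul]

end Literature.AlgebraicGeometry.Deformation.SmoothAffineDeformation

end
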